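import Literature.Analysis.FluidPDE.DuchonRobertLionsEnergyEqualityGeneral
import Literature.Analysis.FluidPDE.NSHopfEnergy

/-!
# Route WazewskiBlock (AnomalousDissipation) — `EnstrophyCapNoLeakage`: the energy equality
  between positive times and the integrated balance under pointwise caps

Helper file for stmt-AnomalousDissipation-1734 (support item `EnstrophyCapNoLeakage` of route
`AnomalousDissipation/WazewskiBlock`; the item itself is closed in
`WazewskiBlockEnstrophyCapNoLeakage.lean`). General dimension `d` throughout.

* **Energy equality between two positive times, without the datum.** The tree's
  `Literature.Analysis.FluidPDE.lions_energy_equality_Ioc'` (Lions 1960 / Shinbrot 1974, `L⁴L⁴`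
  class) needs `u₀ ∈ L²`, which `Torus.IsLerayHopfOn` does NOT imply (no clause constrains the
  measurability of `u₀`). We re-run its Galerkin argument in the form
  "`½‖u(t)‖² + ν∫₀ᵗ‖∇u‖² - ∫₀ᵗ(f,u)` is constant on `(0, T]`": at truncation level `M` the
  identity `‖P_M u(t)‖² = C_M + 2∫_{(0,t]} Φ_M` holds with the SAME constant `C_M` for every
  `t ∈ (0, T]` (`integral_inner_fourierTruncate_self_eq_const_add`; `C_M` is a sum of squares of
  the junk-or-not numbers `∫⟪u₀, g_i⟫` and is never identified with `‖P_M u₀‖²`), and the three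
  limit lemmas of `DuchonRobertLionsEnergyEquality(General)` pass to `M → ∞`
  (`energy_functional_eq_of_memLqLp_four`).
* **Caps ⇒ Lions–Shinbrot class.** `½‖u(t)‖² ≤ E`, `‖∇u(t)‖₂² ≤ G` on `(0,T)` put `u` in
  `L^∞(0,T; H¹) ⊂ L⁴(0,T; L⁴(T^d))`, `2 ≤ d ≤ 4` (`memLqLp_four_of_caps`, via
  `Torus.lintegral_enorm_pow_four_le_eSobolevNorm`).
* **Integrated balance.** Dropping `½‖u(s)‖² ≥ 0`, `ν∫₀ˢ‖∇u‖² ≥ 0` and letting `s → 0⁺` gives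
  `∫₀ᵀ (f,u) ≤ E + ν∫₀ᵀ‖∇u‖²` (`setIntegral_work_le_of_memLqLp_four`).

Sources: J.-L. Lions, Rend. Sem. Mat. Univ. Padova 30 (1960); M. Shinbrot, SIAM J. Math. Anal. 5
(1974), Thm. (`p = r = 4`); Foias–Manley–Rosa–Temam 2001, (12.38)–(12.39); Doering–Foias 2002, §2.
-/

noncomputable section

open MeasureTheory Filter Topology Set
open scoped InnerProductSpace RealInnerProductSpace ENNReal NNReal

namespace Summit.AnomalousDissipation.AnomalousDissipation.Theorems

set_option linter.dupNamespace false

open Literature.Analysis Literature.Analysis.FluidPDE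

section EnergyEquality

variable {d : Type*} [Fintype d] [DecidableEq d] {T ν : ℝ}
  {f u : ℝ → UnitAddTorus d → EuclideanSpace ℝ d} {u₀ : UnitAddTorus d → EuclideanSpace ℝ d}

/-- **The energy identity at truncation level `M`, datum-free form.** For a Leray–Hopf solution
`u` on `T^d × [0, T)`, `T > 0`, with a jointly measurable force `f ∈ L¹(0,T; L²)`, there is a
constant `C` (namely `∑_i ⟨u₀, g_i⟩²` along the frame, whatever the junk status of `u₀`) such
that for every `t ∈ (0, T]`, `‖P_M u(t)‖²_{L²} = C + 2 ∫_{(0,t]} Φ[u; P_M u(s)](s) ds`, the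
integrand being integrable on `(0, t]`. Same proof as
`Torus.IsLerayHopfOn.integral_inner_fourierTruncate_self_eq`, minus the identification of the
constant (which is the only place where `u₀ ∈ L²` was used). -/
theorem integral_inner_fourierTruncate_self_eq_const_add (hu : Torus.IsLerayHopfOn T ν f u₀ u) (hT : 0 < T)
    (hfm : AEStronglyMeasurable (FunctionSpaces.Torus.stLift f) (volume.restrict (Ioo 0 T ×ˢ univ)))
    (hf : Torus.MemLqLp 1 2 f (Ioo 0 T)) (M : ℕ) :
    ∃ C : ℝ, ∀ t ∈ Ioc 0 T,
      IntegrableOn (fun s =>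
        ∫ x, (⟪u s x, FunctionSpaces.Torus.convect (u s) (FunctionSpaces.Torus.fourierTruncate M (u s)) x⟫ +
          ν * ⟪u s x, FunctionSpaces.Torus.laplacian (FunctionSpaces.Torus.fourierTruncate M (u s)) x⟫ +
          ⟪f s x, FunctionSpaces.Torus.fourierTruncate M (u s) x⟫)) (Ioc 0 t) ∧
      ∫ x, ⟪FunctionSpaces.Torus.fourierTruncate M (u t) x, FunctionSpaces.Torus.fourierTruncate M (u t) x⟫ =
        C + 2 * ∫ s in Ioc 0 t,
            ∫ x, (⟪u s x, FunctionSpaces.Torus.convect (u s) (FunctionSpaces.Torus.fourierTruncate M (u s)) x⟫ +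
              ν * ⟪u s x, FunctionSpaces.Torus.laplacian (FunctionSpaces.Torus.fourierTruncate M (u s)) x⟫ +
              ⟪f s x, FunctionSpaces.Torus.fourierTruncate M (u s) x⟫) := by
  classical
  -- ### the frame
  set I : Finset ((d → ℤ) × d × Bool) :=
    FunctionSpaces.Torus.freqBall M ×ˢ ((Finset.univ : Finset d) ×ˢ (Finset.univ : Finset Bool)) with hI
  set a : (d → ℤ) × d × Bool → UnitAddTorus d → EuclideanSpace ℝ d :=
    fun i => Torus.frameField i.1 i.2.1 i.2.2 with ha
  have ha_smooth : ∀ i, FunctionSpaces.Torus.IsSmooth (a i) := fun i => Torus.isSmooth_frameField _ _ _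
  have ha_div : ∀ i, FunctionSpaces.Torus.IsDivFree (a i) := fun i => Torus.isDivFree_frameField' _ _ _
  have hdivu : ∀ s ∈ Ioc 0 T, FunctionSpaces.Torus.IsWeaklyDivFree (u s) := fun s hs =>
    hu.isWeaklyDivFree_of_mem_Ioc hs
  -- ### the coefficient functions, their fluxes and representations
  set A : (d → ℤ) × d × Bool → ℝ → ℝ := fun i s => ∫ x, ⟪u s x, a i x⟫ with hA
  set φ : (d → ℤ) × d × Bool → ℝ → ℝ := fun i s =>
    ∫ x, (⟪u s x, FunctionSpaces.Torus.convect (u s) (a i) x⟫ + ν * ⟪u s x, FunctionSpaces.Torus.laplacian (a i) x⟫ +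
      ⟪f s x, a i x⟫) with hφ
  have hφint : ∀ i, IntegrableOn (φ i) (Ioo 0 T) := fun i => hu.integrableOn_flux_L1L2 hfm hf (ha_smooth i)
  have hArep : ∀ i, ∀ s ∈ Ioc 0 T, A i s = (∫ x, ⟪u₀ x, a i x⟫) + ∫ r in Ioc 0 s, φ i r :=
    fun i s hs => hu.integral_inner_eq_add_setIntegral_L1L2 hT hfm hf (ha_smooth i) (ha_div i) hs
  refine ⟨∑ i ∈ I, (∫ x, ⟪u₀ x, a i x⟫) * ∫ x, ⟪u₀ x, a i x⟫, fun t ht => ?_⟩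
  -- ### the product formula, mode by mode
  have hprod := fun i => FunctionSpaces.mul_eq_add_setIntegral_of_eq_add_setIntegral (hφint i) (hφint i)
    (hArep i) (hArep i) ht
  -- ### sum over the frame
  have hLHS : ∫ x, ⟪FunctionSpaces.Torus.fourierTruncate M (u t) x, FunctionSpaces.Torus.fourierTruncate M (u t) x⟫ =
      ∑ i ∈ I, A i t * A i t :=
    Torus.integral_inner_fourierTruncate_fourierTruncate_eq_sum (hu.memLp t ⟨ht.1.le, ht.2⟩)
      (hu.memLp t ⟨ht.1.le, ht.2⟩) (hdivu t ht) M
  have hsumInt : IntegrableOn (fun s => ∑ i ∈ I, (φ i s * A i s + A i s * φ i s)) (Ioc 0 t) :=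
    integrable_finsetSum I fun i _ => (hprod i).1
  have hsumEq : ∑ i ∈ I, A i t * A i t = ∑ i ∈ I, (∫ x, ⟪u₀ x, a i x⟫) * (∫ x, ⟪u₀ x, a i x⟫) +
      ∫ s in Ioc 0 t, ∑ i ∈ I, (φ i s * A i s + A i s * φ i s) := by
    rw [integral_finsetSum I fun i _ => (hprod i).1, ← Finset.sum_add_distrib]
    exact Finset.sum_congr rfl fun i _ => (hprod i).2
  -- ### identification of the integrand for a.e. `s ∈ (0, t]`
  have hsub : Ioc 0 t ⊆ Ioc 0 T := Ioc_subset_Ioc_right ht.2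
  set Φ : ℝ → ℝ := fun s =>
    ∫ x, (⟪u s x, FunctionSpaces.Torus.convect (u s) (FunctionSpaces.Torus.fourierTruncate M (u s)) x⟫ +
      ν * ⟪u s x, FunctionSpaces.Torus.laplacian (FunctionSpaces.Torus.fourierTruncate M (u s)) x⟫ +
      ⟪f s x, FunctionSpaces.Torus.fourierTruncate M (u s) x⟫) with hΦdef
  have hIdent : ∀ᵐ s ∂(volume.restrict (Ioc 0 t)), ∑ i ∈ I, (φ i s * A i s + A i s * φ i s) = Φ s + Φ s := by
    have h1 : ∀ᵐ s ∂(volume.restrict (Ioc 0 T)), Integrable (f s) volume := by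
      rw [← Measure.restrict_congr_set Ioo_ae_eq_Ioc]
      exact Torus.ae_integrable_force_slice' hf
    have h2 : ∀ᵐ s ∂(volume.restrict (Ioc 0 t)), Integrable (f s) volume :=
      ae_restrict_of_ae_restrict_of_subset hsub h1
    filter_upwards [h2, ae_restrict_mem measurableSet_Ioc] with s hs hsI
    have hsT : s ∈ Ioc 0 T := hsub hsI
    have hus : MemLp (u s) 2 volume := hu.memLp s ⟨hsT.1.le, hsT.2⟩
    have hexp := Torus.fourierTruncate_eq_sum_integral_inner_smul_frameField hus (hdivu s hsT) M
    simp only [hΦdef]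
    rw [Finset.sum_add_distrib]
    congr 1
    · calc ∑ i ∈ I, φ i s * A i s = ∑ i ∈ I, A i s * φ i s := Finset.sum_congr rfl fun i _ => mul_comm _ _
        _ = _ := Torus.sum_mul_flux_eq I (fun i => A i s) ha_smooth ν hus hs
        _ = _ := by rw [hexp]
    · calc ∑ i ∈ I, A i s * φ i s = _ := Torus.sum_mul_flux_eq I (fun i => A i s) ha_smooth ν hus hs
        _ = _ := by rw [hexp]
  have hΦ2 : IntegrableOn (fun s => Φ s + Φ s) (Ioc 0 t) := hsumInt.congr hIdent
  have hΦ : IntegrableOn Φ (Ioc 0 t) :=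
    (hΦ2.const_mul (2⁻¹ : ℝ)).congr (ae_of_all _ fun s => by ring)
  refine ⟨hΦ, ?_⟩
  rw [hLHS, hsumEq, integral_congr_ae hIdent, integral_add hΦ hΦ, two_mul]

/-- **Energy equality between two positive times for Leray–Hopf solutions of the Lions–Shinbrot
class `L⁴(0,T; L⁴)`, datum-free form** (J.-L. Lions 1960; Shinbrot 1974, Thm., `p = r = 4`):
for a Leray–Hopf solution `u` on `T^d × [0, T)` with `u ∈ L⁴(0,T; L⁴)` and a jointly measurable
force `f ∈ L¹(0,T; L²)`, the energy functional
`t ↦ ½‖u(t)‖² + ν ∫₀ᵗ ‖∇u‖₂² - ∫₀ᵗ ∫⟪f, u⟫` is constant on `(0, T]` — i.e. the energy EQUALITY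
holds between any two positive times. Unlike `lions_energy_equality_Ioc'` no hypothesis on the
datum `u₀` is needed (the level-`N` constants of
`integral_inner_fourierTruncate_self_eq_const_add` converge, to a limit independent of `t`). -/
theorem energy_functional_eq_of_memLqLp_four (hu : Torus.IsLerayHopfOn T ν f u₀ u)
    (hu4 : Torus.MemLqLp 4 4 u (Ioo 0 T))
    (hfm : AEStronglyMeasurable (FunctionSpaces.Torus.stLift f) (volume.restrict (Ioo 0 T ×ˢ univ)))
    (hf : Torus.MemLqLp 1 2 f (Ioo 0 T)) {s t : ℝ} (hs : s ∈ Ioc 0 T) (ht : t ∈ Ioc 0 T) :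
    FunctionSpaces.Torus.kineticEnergy (u t) + ν * (∫⁻ τ in Ioo 0 t, FunctionSpaces.Torus.eGradNormSq (u τ)).toReal -
        ∫ τ in Ioc 0 t, ∫ x, ⟪f τ x, u τ x⟫ =
      FunctionSpaces.Torus.kineticEnergy (u s) + ν * (∫⁻ τ in Ioo 0 s, FunctionSpaces.Torus.eGradNormSq (u τ)).toReal -
        ∫ τ in Ioc 0 s, ∫ x, ⟪f τ x, u τ x⟫ := by
  have hT : 0 < T := hs.1.trans_le hs.2
  -- the level-`N` constants
  choose C hC using fun N => integral_inner_fourierTruncate_self_eq_const_add hu hT hfm hf N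
  -- ### the constants converge to (twice) the energy functional at every `r ∈ (0, T]`
  have key : ∀ r ∈ Ioc 0 T, Tendsto C atTop (𝓝 ((∫ x, ‖u r x‖ ^ 2) -
      2 * ((0 - ν * (∫⁻ τ in Ioo 0 r, FunctionSpaces.Torus.eGradNormSq (u τ)).toReal) +
        ∫ τ in Ioc 0 r, ∫ x, ⟪f τ x, u τ x⟫))) := by
    intro r hr
    have hr' : r ∈ Icc 0 T := ⟨hr.1.le, hr.2⟩
    set L : ℕ → ℝ := fun N => ∫ x, ⟪FunctionSpaces.Torus.fourierTruncate N (u r) x,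
      FunctionSpaces.Torus.fourierTruncate N (u r) x⟫ with hL
    set NL : ℕ → ℝ := fun N => ∫ s in Ioc 0 r,
      ∫ x, ⟪u s x, FunctionSpaces.Torus.convect (u s) (FunctionSpaces.Torus.fourierTruncate N (u s)) x⟫ with hNL
    set D : ℕ → ℝ := fun N => ∫ s in Ioc 0 r,
      (FunctionSpaces.Torus.eGradNormSq (FunctionSpaces.Torus.fourierTruncate N (u s))).toReal with hD
    set W : ℕ → ℝ := fun N => ∫ s in Ioc 0 r, ∫ x, ⟪f s x, FunctionSpaces.Torus.fourierTruncate N (u s) x⟫ with hW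
    obtain ⟨hNLint, hNLlim⟩ := hu.tendsto_setIntegral_inner_convect_fourierTruncate_self' hu4 hr
    obtain ⟨hDint, hDlim⟩ := hu.tendsto_setIntegral_toReal_eGradNormSq_fourierTruncate hr
    obtain ⟨hWint, hWlim⟩ := hu.tendsto_setIntegral_work_fourierTruncate hfm hf hr
    -- the identity at level `N`
    have hN : ∀ N, C N = L N - 2 * ((NL N - ν * D N) + W N) := by
      intro N
      obtain ⟨-, hid⟩ := hC N r hr
      have h1 : ∀ᵐ s ∂(volume.restrict (Ioc 0 T)), Integrable (f s) volume := by
        rw [← Measure.restrict_congr_set Ioo_ae_eq_Ioc]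
        exact Torus.ae_integrable_force_slice' hf
      have hsplit : ∀ᵐ s ∂(volume.restrict (Ioc 0 r)),
          (∫ x, (⟪u s x, FunctionSpaces.Torus.convect (u s) (FunctionSpaces.Torus.fourierTruncate N (u s)) x⟫ +
            ν * ⟪u s x, FunctionSpaces.Torus.laplacian (FunctionSpaces.Torus.fourierTruncate N (u s)) x⟫ +
            ⟪f s x, FunctionSpaces.Torus.fourierTruncate N (u s) x⟫)) =
          (∫ x, ⟪u s x, FunctionSpaces.Torus.convect (u s) (FunctionSpaces.Torus.fourierTruncate N (u s)) x⟫) -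
            ν * (FunctionSpaces.Torus.eGradNormSq (FunctionSpaces.Torus.fourierTruncate N (u s))).toReal +
            ∫ x, ⟪f s x, FunctionSpaces.Torus.fourierTruncate N (u s) x⟫ := by
        filter_upwards [ae_restrict_of_ae_restrict_of_subset (Ioc_subset_Ioc_right hr.2) h1,
          ae_restrict_mem measurableSet_Ioc] with s hs hsI
        exact Torus.flux_fourierTruncate_self_split (hu.memLp s ⟨hsI.1.le, hsI.2.trans hr.2⟩) hs ν N
      have iD : IntegrableOn (fun s =>
          ν * (FunctionSpaces.Torus.eGradNormSq (FunctionSpaces.Torus.fourierTruncate N (u s))).toReal) (Ioc 0 r) :=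
        (hDint N).const_mul ν
      have iND : IntegrableOn (fun s =>
          (∫ x, ⟪u s x, FunctionSpaces.Torus.convect (u s) (FunctionSpaces.Torus.fourierTruncate N (u s)) x⟫) -
            ν * (FunctionSpaces.Torus.eGradNormSq (FunctionSpaces.Torus.fourierTruncate N (u s))).toReal) (Ioc 0 r) :=
        (hNLint N).sub iD
      rw [hL, hNL, hD, hW]
      dsimp only
      rw [hid, integral_congr_ae hsplit, integral_add iND (hWint N), integral_sub (hNLint N) iD,
        integral_const_mul]
      ring
    -- the limits
    have hLlim : Tendsto L atTop (𝓝 (∫ x, ‖u r x‖ ^ 2)) :=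
      Torus.tendsto_integral_inner_fourierTruncate_self (hu.memLp r hr')
    have hRlim : Tendsto (fun N => L N - 2 * ((NL N - ν * D N) + W N)) atTop
        (𝓝 ((∫ x, ‖u r x‖ ^ 2) - 2 * ((0 - ν * (∫⁻ τ in Ioo 0 r, FunctionSpaces.Torus.eGradNormSq (u τ)).toReal) +
          ∫ τ in Ioc 0 r, ∫ x, ⟪f τ x, u τ x⟫))) :=
      hLlim.sub (((hNLlim.sub (hDlim.const_mul ν)).add hWlim).const_mul 2)
    exact hRlim.congr fun N => (hN N).symm
  have huniq := tendsto_nhds_unique (key t ht) (key s hs)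
  simp only [FunctionSpaces.Torus.kineticEnergy]
  linarith

end EnergyEquality

/-! ### From the pointwise caps to the Lions–Shinbrot class and to the integrated balance -/

section Caps

variable {d : Type*} [Fintype d] [DecidableEq d] {T ν : ℝ}
  {f u : ℝ → UnitAddTorus d → EuclideanSpace ℝ d} {u₀ : UnitAddTorus d → EuclideanSpace ℝ d}

omit [DecidableEq d] in
/-- A slice with `½‖v‖² ≤ E` and `‖∇v‖₂² ≤ G` has `∫ ‖v‖⁴ ≤ K (2E + G)²`, `K` the constant of the
embedding `H¹(T^d) ⊂ L⁴(T^d)` (`‖v‖²_{H¹} ≤ ‖v‖²_{L²} + ‖∇v‖₂²`,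
`Torus.eSobolevNorm_one_complexify_sq_le`). -/
theorem lintegral_enorm_pow_four_le_of_caps {K : ℝ≥0}
    (hK : ∀ v : UnitAddTorus d → EuclideanSpace ℝ d, MemLp v 2 volume →
      ∫⁻ x, ‖v x‖ₑ ^ 4 ≤ K * FunctionSpaces.Torus.eSobolevNorm 1 (FunctionSpaces.EuclideanSpace.complexify ∘ v) ^ 4)
    {v : UnitAddTorus d → EuclideanSpace ℝ d} (hv : MemLp v 2 volume) {E : ℝ} {G : ℝ≥0}
    (hE : FunctionSpaces.Torus.kineticEnergy v ≤ E) (hG : FunctionSpaces.Torus.eGradNormSq v ≤ G) :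
    ∫⁻ x, ‖v x‖ₑ ^ 4 ≤ K * (ENNReal.ofReal (2 * E) + G) ^ 2 := by
  have hH2 : FunctionSpaces.Torus.eSobolevNorm 1 (FunctionSpaces.EuclideanSpace.complexify ∘ v) ^ 2 ≤
      ENNReal.ofReal (2 * E) + G := by
    refine (Torus.eSobolevNorm_one_complexify_sq_le hv).trans (add_le_add ?_ hG)
    rw [Torus.lintegral_enorm_sq_eq_ofReal hv]
    refine ENNReal.ofReal_le_ofReal ?_
    have h2 : ∫ x, ‖v x‖ ^ 2 = 2 * FunctionSpaces.Torus.kineticEnergy v := by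
      simp only [FunctionSpaces.Torus.kineticEnergy]; ring
    rw [h2]; linarith
  calc ∫⁻ x, ‖v x‖ₑ ^ 4
      ≤ K * FunctionSpaces.Torus.eSobolevNorm 1 (FunctionSpaces.EuclideanSpace.complexify ∘ v) ^ 4 := hK v hv
    _ = K * (FunctionSpaces.Torus.eSobolevNorm 1 (FunctionSpaces.EuclideanSpace.complexify ∘ v) ^ 2) ^ 2 := by ring
    _ ≤ K * (ENNReal.ofReal (2 * E) + G) ^ 2 := by gcongr

/-- **The caps put a Leray–Hopf solution in `L⁴(0,T; L⁴(T^d))`, `2 ≤ d ≤ 4`**: if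
`½‖u(t)‖² ≤ E` and `‖∇u(t)‖₂² ≤ G` for `t ∈ (0, T)`, then every such slice is in `L⁴` with
`‖u(t)‖_{L⁴} ≤ (K(2E+G)²)^{1/4}` (`H¹ ⊂ L⁴`, `Torus.lintegral_enorm_pow_four_le_eSobolevNorm`),
and a bounded function of time on `(0, T)` has finite `L⁴` norm (guarded mixed class
`Torus.MemLqLp 4 4`). -/
theorem memLqLp_four_of_caps (hd2 : 2 ≤ Fintype.card d) (hd4 : Fintype.card d ≤ 4)
    (hu : Torus.IsLerayHopfOn T ν f u₀ u) {E : ℝ} {G : ℝ≥0}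
    (hcap : ∀ t ∈ Ioo 0 T, FunctionSpaces.Torus.kineticEnergy (u t) ≤ E ∧ FunctionSpaces.Torus.eGradNormSq (u t) ≤ G) :
    Torus.MemLqLp 4 4 u (Ioo 0 T) := by
  obtain ⟨K, hK⟩ := FunctionSpaces.Torus.lintegral_enorm_pow_four_le_eSobolevNorm (d := d) hd2 hd4
  set B : ℝ≥0∞ := K * (ENNReal.ofReal (2 * E) + G) ^ 2 with hB
  have hBtop : B ≠ ⊤ :=
    ENNReal.mul_ne_top ENNReal.coe_ne_top
      (ENNReal.pow_ne_top (ENNReal.add_ne_top.2 ⟨ENNReal.ofReal_ne_top, ENNReal.coe_ne_top⟩))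
  have hB4 : B ^ (1 / 4 : ℝ) ≠ ⊤ := ENNReal.rpow_ne_top_of_nonneg (by norm_num) hBtop
  have hslice : ∀ t ∈ Ioo 0 T, eLpNorm (u t) 4 volume ≤ B ^ (1 / 4 : ℝ) := fun t ht => by
    have hmem : MemLp (u t) 2 volume := hu.memLp t (Ioo_subset_Icc_self ht)
    rw [Torus.eLpNorm_four_eq_lintegral_rpow]
    exact ENNReal.rpow_le_rpow (lintegral_enorm_pow_four_le_of_caps hK hmem (hcap t ht).1 (hcap t ht).2)
      (by norm_num)
  refine ⟨?_, ?_⟩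
  · filter_upwards [ae_restrict_mem measurableSet_Ioo] with t ht
    exact ⟨(hu.memLp t (Ioo_subset_Icc_self ht)).1, (hslice t ht).trans_lt (lt_top_iff_ne_top.2 hB4)⟩
  · -- the mixed norm: a bounded function of time on a set of finite measure
    show eLpNorm (fun t => (eLpNorm (u t) 4 volume).toReal) 4 (volume.restrict (Ioo 0 T)) < ⊤
    have hbd : ∀ᵐ t ∂(volume.restrict (Ioo 0 T)), ‖(eLpNorm (u t) 4 volume).toReal‖ ≤ (B ^ (1 / 4 : ℝ)).toReal := by
      filter_upwards [ae_restrict_mem measurableSet_Ioo] with t ht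
      rw [Real.norm_eq_abs, abs_of_nonneg ENNReal.toReal_nonneg]
      exact ENNReal.toReal_mono hB4 (hslice t ht)
    refine (eLpNorm_le_of_ae_bound hbd).trans_lt (ENNReal.mul_lt_top ?_ ENNReal.ofReal_lt_top)
    refine ENNReal.rpow_lt_top_of_nonneg (by positivity) ?_
    rw [Measure.restrict_apply_univ]
    exact measure_Ioo_lt_top.ne

omit [DecidableEq d] in
/-- **The work of a bounded force on a slice of bounded energy is bounded**:
`|∫⟪F, v⟫| ≤ ‖F‖_∞ · ½(1 + 2E)` when `½‖v‖²_{L²} ≤ E` (crude Cauchy–Schwarz on the unit torus). -/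
theorem abs_integral_inner_le_of_kineticEnergy_le {F v : UnitAddTorus d → EuclideanSpace ℝ d}
    (hv : MemLp v 2 volume) {KF E : ℝ} (hKF : ∀ x, ‖F x‖ ≤ KF)
    (hE : FunctionSpaces.Torus.kineticEnergy v ≤ E) :
    |∫ x, ⟪F x, v x⟫| ≤ KF * (2⁻¹ * (1 + 2 * E)) := by
  have hKF0 : 0 ≤ KF := (norm_nonneg _).trans (hKF 0)
  have hswap : ∫ x, ⟪F x, v x⟫ = ∫ x, ⟪v x, F x⟫ :=
    integral_congr_ae (ae_of_all _ fun x => real_inner_comm (v x) (F x))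
  rw [hswap]
  refine (Torus.abs_integral_inner_le_of_norm_le (hv.integrable one_le_two) hKF).trans ?_
  refine mul_le_mul_of_nonneg_left ((Torus.integral_norm_le_of_memLp_two hv).trans ?_) hKF0
  have h2 : ∫ x, ‖v x‖ ^ 2 = 2 * FunctionSpaces.Torus.kineticEnergy v := by
    simp only [FunctionSpaces.Torus.kineticEnergy]; ring
  rw [h2]
  linarith

/-- **The integrated energy balance under an energy cap**: for a Leray–Hopf solution of the
`L⁴(0,T; L⁴)` class (`ν ≥ 0`, jointly measurable force `f ∈ L¹(0,T; L²)`) whose work is bounded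
slice-wise on `(0, T]` and whose terminal energy is at most `E`,
`∫₀ᵀ ∫⟪f, u⟫ ≤ E + ν ∫₀ᵀ ‖∇u‖₂²` — the energy equality between `s` and `T`
(`energy_functional_eq_of_memLqLp_four`), dropping `½‖u(s)‖² ≥ 0` and `ν∫₀ˢ‖∇u‖₂² ≥ 0`, and
`s → 0⁺` (the early work `∫₀ˢ ∫⟪f,u⟫` is `O(s)`). -/
theorem setIntegral_work_le_of_memLqLp_four (hν : 0 ≤ ν) (hu : Torus.IsLerayHopfOn T ν f u₀ u) (hT : 0 < T)
    (hu4 : Torus.MemLqLp 4 4 u (Ioo 0 T))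
    (hfm : AEStronglyMeasurable (FunctionSpaces.Torus.stLift f) (volume.restrict (Ioo 0 T ×ˢ univ)))
    (hf : Torus.MemLqLp 1 2 f (Ioo 0 T)) {E A : ℝ} (hET : FunctionSpaces.Torus.kineticEnergy (u T) ≤ E)
    (hA : ∀ τ ∈ Ioc 0 T, |∫ x, ⟪f τ x, u τ x⟫| ≤ A) :
    ∫ τ in Ioc 0 T, ∫ x, ⟪f τ x, u τ x⟫ ≤
      E + ν * (∫⁻ τ in Ioo 0 T, FunctionSpaces.Torus.eGradNormSq (u τ)).toReal := by
  have hA0 : 0 ≤ A := (abs_nonneg _).trans (hA T ⟨hT, le_rfl⟩)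
  refine le_of_forall_pos_le_add fun ε hε => ?_
  -- a small positive time `s`
  obtain ⟨s, hs0, hsT, hsε⟩ : ∃ s : ℝ, 0 < s ∧ s ≤ T ∧ A * s ≤ ε := by
    refine ⟨min T (ε / (A + 1)), lt_min hT (div_pos hε (by linarith)), min_le_left _ _, ?_⟩
    calc A * min T (ε / (A + 1)) ≤ A * (ε / (A + 1)) :=
          mul_le_mul_of_nonneg_left (min_le_right _ _) hA0
      _ ≤ (A + 1) * (ε / (A + 1)) := mul_le_mul_of_nonneg_right (by linarith) (div_pos hε (by linarith)).le
      _ = ε := by field_simp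
  have hs : s ∈ Ioc 0 T := ⟨hs0, hsT⟩
  have heq := energy_functional_eq_of_memLqLp_four hu hu4 hfm hf hs ⟨hT, le_rfl⟩
  -- the early work is small
  have hWs : ∫ τ in Ioc 0 s, ∫ x, ⟪f τ x, u τ x⟫ ≤ ε := by
    have h1 : ‖∫ τ in Ioc 0 s, ∫ x, ⟪f τ x, u τ x⟫‖ ≤ A * volume.real (Ioc 0 s) :=
      norm_setIntegral_le_of_norm_le_const measure_Ioc_lt_top fun τ hτ => by
        rw [Real.norm_eq_abs]; exact hA τ ⟨hτ.1, hτ.2.trans hsT⟩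
    rw [Real.volume_real_Ioc_of_le hs0.le, sub_zero, Real.norm_eq_abs] at h1
    exact (le_abs_self _).trans (h1.trans hsε)
  have hKs : 0 ≤ FunctionSpaces.Torus.kineticEnergy (u s) := FunctionSpaces.Torus.kineticEnergy_nonneg _
  have hDs : 0 ≤ ν * (∫⁻ τ in Ioo 0 s, FunctionSpaces.Torus.eGradNormSq (u τ)).toReal :=
    mul_nonneg hν ENNReal.toReal_nonneg
  linarith

omit [DecidableEq d] in
/-- A steady field lifted to space–time is in the guarded mixed class `L¹(0,T; L²)` as soon as it
is in `L²(T^d)` (constant slice norm on an interval of finite length). -/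
theorem memLqLp_one_two_const {F : UnitAddTorus d → EuclideanSpace ℝ d} (hF : MemLp F 2 volume) (T : ℝ) :
    Torus.MemLqLp 1 2 (fun _ : ℝ => F) (Ioo 0 T) := by
  haveI : IsFiniteMeasure (volume.restrict (Ioo (0 : ℝ) T)) :=
    ⟨by rw [Measure.restrict_apply_univ]; exact measure_Ioo_lt_top⟩
  exact ⟨ae_of_all _ fun _ => hF, (memLp_const (eLpNorm F 2 volume).toReal).2⟩

end Caps

end Summit.AnomalousDissipation.AnomalousDissipation.Theorems
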